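import Summits.ResolutionOfSingularities.ResolutionOfSingularities.Theorems.FrobeniusLadderFInjectiveMacaulayficationWildPinchCylinderAxis
import Summits.ResolutionOfSingularities.ResolutionOfSingularities.Theorems.FrobeniusLadderFInjectiveMacaulayficationGoodOverRegularCentre
import HarnessLib

/-!
# WITNESS 2, datum (d4): blow-ups of the wild-pinch cylinder along the `t`-axis ideal `I_C` are GOOD over `C ∖ {b}`
# (crux `FInjectiveMacaulayfication` stmt-ResolutionOfSingularities-15315, chain w45a; res-L1-w45a-plan-1 R16.49 «(d4)-TAKER = stub-2»; interface of
# res-L1-w45a-stub-3 22:17:07Z; seat res-L1-w45a-stub-2)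

[OURS · L1 W4.5a] Support file (`--supports stmt-ResolutionOfSingularities-15315 --as helper`); NOT a statement of any manuscript; def-free; AI-written (AI review is
weaker than expert review).

SETTING (res-L1-w45a-stub-3 `…WildPinchCylinder[Axis]`): `X₁ = Spec k[u,t,y,v₁,v₂]/(F)`, `F = y² + u²ty + ut²`, `char k = 2`; `I_C` = the ideal sheaf of the
`t`-axis `C = V(u, y, v₁, v₂)`; `b` = the origin. §1 the basic open `W = D(t̄)` is REGULAR (`WildPinchCylinder.isRegularLocalRing_of_X1_not_mem`, Jacobian
criterion) and contains `supp I_C ∖ {b}` (`WildPinchCylinderAxis.X1_not_mem_of_P0234_le`); stalks of schemes over `X₁` have characteristic `2`.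
§2 `goodOver_IC_off_origin_of_isRegular_centre (hC)`: modulo the regularity of the restricted centre `(I_C|_W).subscheme = C ∩ D(t̄) (≅ Spec k[t,t⁻¹])`,
every blow-up along `I_C` is GOOD (indeed FULL) over `supp I_C ∖ {b}` (`GoodOverRegularCentre.goodOver_of_isRegular_centre_over_open`, Liu 8.1.19 (a)).
The hypothesis `hC` is the concrete identification `C ∩ D(t̄) ≅ Spec k[t][1/t]` — part (b), separate file. [cite: Liu2002, Thm. 8.1.19 (a)]
-/

-- single-problem summit: the doubled namespace component is forced
set_option linter.dupNamespace false

noncomputable section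

namespace Summit.ResolutionOfSingularities.ResolutionOfSingularities.Theorems.FInjectiveMacaulayfication.WildPinchCylinderAxisGood

open CategoryTheory AlgebraicGeometry TopologicalSpace IsLocalRing MvPolynomial
open Literature.AlgebraicGeometry.Resolution
open Summit.ResolutionOfSingularities.ResolutionOfSingularities.Theorems.FInjectiveMacaulayfication
open FCUnguardedAprime SliceableCentre

variable (k : Type) [Field k] [CharP k 2] (F : MvPolynomial (Fin 5) k) (hF : F = X 2 ^ 2 + X 0 ^ 2 * X 1 * X 2 + X 0 * X 1 ^ 2)

/-! ## §1 The regular open `D(t̄)` -/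

include hF in
/-- **`D(t̄) ⊆ X₁` is a regular open**: its local rings are the `A_𝔭`, `t̄ ∉ 𝔭`, regular by the Jacobian criterion (`∂F/∂u = t²`).
[cite: Matsumura1987, Thm. 30.4] -/
theorem isRegular_basicOpen_X1 : Scheme.IsRegular ((⟨(PrimeSpectrum.basicOpen (Ideal.Quotient.mk (Ideal.span {F}) (X 1)) : Set (PrimeSpectrum (MvPolynomial (Fin 5) k ⧸ Ideal.span {F}))), PrimeSpectrum.isOpen_basicOpen⟩ : (Spec (.of (MvPolynomial (Fin 5) k ⧸ Ideal.span {F}))).Opens) : Scheme.{0}) := by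
  intro w
  have ht : (Ideal.Quotient.mk (Ideal.span {F}) (X 1)) ∉ w.1.asIdeal := w.2
  haveI := WildPinchCylinder.isRegularLocalRing_of_X1_not_mem k F hF w.1.asIdeal ht
  have e1 := (Scheme.Opens.stalkIso (⟨(PrimeSpectrum.basicOpen (Ideal.Quotient.mk (Ideal.span {F}) (X 1)) : Set (PrimeSpectrum (MvPolynomial (Fin 5) k ⧸ Ideal.span {F}))), PrimeSpectrum.isOpen_basicOpen⟩ : (Spec (.of (MvPolynomial (Fin 5) k ⧸ Ideal.span {F}))).Opens) w).commRingCatIsoToRingEquiv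
  have e2 := (Spec.stalkIso (.of (MvPolynomial (Fin 5) k ⧸ Ideal.span {F})) w.1).commRingCatIsoToRingEquiv
  haveI := IsRegularLocalRing.of_ringEquiv e2.symm
  exact IsRegularLocalRing.of_ringEquiv e1.symm

omit [CharP k 2] in
/-- Stalks of any scheme over `X₁` have characteristic `2`. [plumbing] -/
theorem charP_stalk_of_hom [CharP k 2] {X₂ : Scheme.{0}} (π : X₂ ⟶ (Spec (.of (MvPolynomial (Fin 5) k ⧸ Ideal.span {F})))) (x : X₂) : CharP (X₂.presheaf.stalk x) 2 :=
  CharP.of_ringHom_of_ne_zero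
    ((π.stalkMap x).hom.comp (((Spec (.of (MvPolynomial (Fin 5) k ⧸ Ideal.span {F}))).presheaf.germ ⊤ (π.base x) trivial).hom.comp
      ((Scheme.ΓSpecIso (.of (MvPolynomial (Fin 5) k ⧸ Ideal.span {F}))).inv.hom.comp ((Ideal.Quotient.mk (Ideal.span {F})).comp MvPolynomial.C)))) 2 two_ne_zero

/-! ## §2 (d4) modulo the regularity of the restricted centre -/

set_option maxHeartbeats 800000 in -- the long concrete statement (Spec of a quotient, nested ideal-sheaf terms); no change of meaning
include hF in
/-- **(d4) modulo `hC`**: if the restricted centre `(I_C|_{D(t̄)}).subscheme = C ∩ D(t̄)` is a regular scheme, then EVERY blow-up of `X₁` along `I_C` is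
GOOD over `supp I_C ∖ {b}` (indeed FULL at every point over `D(t̄)`). [OURS · conditional on `hC`] [cite: Liu2002, Thm. 8.1.19 (a)] -/
theorem goodOver_IC_off_origin_of_isRegular_centre (b : (Spec (.of (MvPolynomial (Fin 5) k ⧸ Ideal.span {F})))) (hb : b.asIdeal = ((Ideal.span (MvPolynomial.X '' (Set.univ : Set (Fin 5)) : Set (MvPolynomial (Fin 5) k))).map (Ideal.Quotient.mk (Ideal.span {F}))))
    (hC : Scheme.IsRegular (((Scheme.IdealSheafData.ofIdealTop (((Ideal.span (MvPolynomial.X '' ({0, 2, 3, 4} : Set (Fin 5)) : Set (MvPolynomial (Fin 5) k))).map (Ideal.Quotient.mk (Ideal.span {F}))).map (Scheme.ΓSpecIso (.of (MvPolynomial (Fin 5) k ⧸ Ideal.span {F}))).inv.hom)) : (Spec (.of (MvPolynomial (Fin 5) k ⧸ Ideal.span {F}))).IdealSheafData).comap (Scheme.Opens.ι (⟨(PrimeSpectrum.basicOpen (Ideal.Quotient.mk (Ideal.span {F}) (X 1)) : Set (PrimeSpectrum (MvPolynomial (Fin 5) k ⧸ Ideal.span {F}))), PrimeSpectrum.isOpen_basicOpen⟩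 : (Spec (.of (MvPolynomial (Fin 5) k ⧸ Ideal.span {F}))).Opens))).subscheme) :
    GoodOver 2 (Spec (.of (MvPolynomial (Fin 5) k ⧸ Ideal.span {F}))) ((Scheme.IdealSheafData.ofIdealTop (((Ideal.span (MvPolynomial.X '' ({0, 2, 3, 4} : Set (Fin 5)) : Set (MvPolynomial (Fin 5) k))).map (Ideal.Quotient.mk (Ideal.span {F}))).map (Scheme.ΓSpecIso (.of (MvPolynomial (Fin 5) k ⧸ Ideal.span {F}))).inv.hom)) : (Spec (.of (MvPolynomial (Fin 5) k ⧸ Ideal.span {F}))).IdealSheafData) ((((Scheme.IdealSheafData.ofIdealTop (((Ideal.span (MvPolynomial.X '' ({0, 2, 3, 4} : Set (Fin 5)) : Set (MvPolynomial (Fin 5) k))).map (Ideal.Quotient.mk (Ideal.span {F}))).map (Scheme.ΓSpecIso (.of (MvPolynomial (Fin 5) k ⧸ Ideal.span {F}))).inv.hom)) : (Spec (.of (MvPolynomial (Fin 5) k ⧸ Ideal.span {F}))).IdealSheafData).support : Set (Spec (.of (MvPolynomial (Fin 5) k ⧸ Ideal.span {F})))) \ {b}) := by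
  refine GoodOverRegularCentre.goodOver_of_isRegular_centre_over_open _ _ (isRegular_basicOpen_X1 k F hF) hC 2 Nat.prime_two
    (fun X₂ π _ x => charP_stalk_of_hom k F π x) _ fun x hx => ?_
  have hxC := (WildPinchCylinderAxis.mem_support_IC_iff k F x).mp hx.1
  have hxb : x.asIdeal ≠ ((Ideal.span (MvPolynomial.X '' (Set.univ : Set (Fin 5)) : Set (MvPolynomial (Fin 5) k))).map (Ideal.Quotient.mk (Ideal.span {F}))) := fun h => hx.2 (PrimeSpectrum.ext (h.trans hb.symm))
  exact WildPinchCylinderAxis.X1_not_mem_of_P0234_le k F hF x hxC hxb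

end Summit.ResolutionOfSingularities.ResolutionOfSingularities.Theorems.FInjectiveMacaulayfication.WildPinchCylinderAxisGood

end
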